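import Summits.KontsevichZagierPeriods.KontsevichZagierPeriods.Theorems.RootDecompRationalCubeDichotomySimpleBranchStatements

/-!
# Route RootDecompRationalCubeDichotomy — item 27842 `PiRationalisationSimpleBranch` PROVED, part 8/11 (`RootDecompRationalCubeDichotomySimpleBranchBoxChain`)

Theorems-split (≤ 400 lines each, sequential imports) of the decomp-kz lens-2 gen-4 file
`run/shared/lean/pub/decomp-kz/decomp-kz-lens-2/g4/PiRationalisationSimpleBranch27842.lean` (2963 lines; lens farm rc 0, writer re-check
rc 0 audit proof-of-item closed:true, critic g2 by-name probe std axioms, 2026-08-30T05:27:57Z/06:02:52Z). The rung: for simple-branch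
Nash data (`F(x,g) = 0`, `∂_z F(x,g) ≠ 0` on the closed cube) `[π]^K·[s] ∈ relations ⊔ ⟨rational closed-cube sector⟩` for all `K ≥ 1` —
root isolation on rational sub-boxes, the Green band move (planar Stokes inside the four moves), the half winding number ≡ 4[A] ≡ [π],
box rescaling, and `PiTimesSector` (item 26388, landed). The final part closes the ROUTE ITEM by name
(`piRationalisationSimpleBranch_proof`). Sector lemmas are REUSED from the landed rung-24903 file `…PiRationalisationSqrtMoves`.
[Kontsevich–Zagier 2001 §1.2; argument principle] Standard axioms, 0 sorry.
-/

noncomputable section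

set_option linter.dupNamespace false

namespace Summit.KontsevichZagierPeriods.RootDecompRationalCubeDichotomy.Rung27842.SimpleBranch

open Summit.KontsevichZagierPeriods.RootDecompRationalCubeDichotomy.Rung24903 (of_sub_of_mem_relations_of_fibreMap)
open MeasureTheory Set MvPolynomial
open Literature.NumberTheory.Transcendental Literature.NumberTheory.Transcendental.KZ
open Literature.ModelTheory.ExponentialFields (IsSemialgebraic)
open Summit.KontsevichZagierPeriods.KontsevichZagierPeriods.Theses.RootDecompRationalCubeDichotomy
  (PiTimesSector PiRationalisationSimpleBranch)
open Summit.KontsevichZagierPeriods.RootDecompRationalCubeDichotomy.Rung27842.RootIso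

/-! ### Gen-4 second pass: the finer split of statement B (`BoxChain ⟸ GreenReduction ∧ BoxRescale`, with the
pole contribution `poleContribution`, the half winding number `halfWinding` and Green's formula
`of_sub_of_mem_relations_green` (file `g4/scratch/PlanarStokes.lean`) PROVED) -/

/-- The rational-BOX sector: representations `[Π[loᵢ,hiᵢ], P/Q]` with rational corners, `Q` zero-free on the box.
(The outer three sides of the upper half-rectangle land here.) -/
def RatBoxSet : Set FormalRep :=
  {x : FormalRep | ∃ (m : ℕ) (q : IntegralRep m) (lo hi : Fin m → ℚ) (P Q : MvPolynomial (Fin m) ℚ),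
    (∀ i, lo i < hi i) ∧ q.domain = Set.pi Set.univ (fun i : Fin m => Set.Icc ((lo i : ℚ) : ℝ) (hi i)) ∧
    (∀ z ∈ q.domain, aeval z Q ≠ 0) ∧ (∀ z ∈ q.domain, q.integrand z = aeval z P / aeval z Q) ∧ x = of q}

/-- Intermediate statement B2 (M, generic bookkeeping): **rational boxes rescale into the unit cube** — the diagonal affine
substitution `zᵢ = loᵢ + (hiᵢ − loᵢ) tᵢ` (rule 2); e.g. `m` fibrewise affine moves
`KZ.of_sub_of_mem_relations_of_affine` / `of_sub_of_mem_relations_of_fibreMap` interleaved with coordinate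
rotations `KZ.of_sub_of_reindex_mem_relations`) carries `[Π[loᵢ,hiᵢ], P/Q]` to a rational closed-unit-cube
representation. Why it might fail: it cannot (pure bookkeeping); size M. -/
def BoxRescale : Prop := ∀ y ∈ RatBoxSet, y ∈ relations ⊔ AddSubgroup.closure ratCubeSet

/-- Intermediate statement B1 (L, load-bearing): **Green reduction on an isolated box.** On a rational box over which the
rectangle `[a,b] × [−c,c]` isolates the simple real branch `g` with margin `ε`, the POLE CONTRIBUTION
`[P₁] + [P₂]` (what is left of the three upper sides of the square of side `ε` around `g(x)` after the exact
cancellations; see `poleContribution`) lies in `relations ⊔ ⟨rational-box sector⟩`. Plan: Green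
(`of_sub_of_mem_relations_green`) on the three Nash-edged rectangles `[a, g−ε]×[0,c]`, `[g+ε, b]×[0,c]`,
`[g−ε, g+ε]×[ε,c]` of the UPPER half-annulus for the closed pair `(P, Q) = (Im, Re)(z F_z/F)` (rational in `(x,u,v)`,
regular off the zeros of `F(x, u+iv)`), plus Green on the half-square for the holomorphic part `z G_z/G`,
`G = F/(z−g(x))` (Nash coefficients; zero-free by isolation and `F_z(x,g(x)) ≠ 0`); the real-axis segments carry the
ZERO integrand (`F` real ⇒ `Im = 0` at `v = 0`); the `1` of `z/(z−g) = 1 + g/(z−g)` cancels exactly; the inner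
boundary leaves `[P₁] + [P₂]`, the outer boundary three rational-box representations. UPPER HALF ONLY — never
`2w ∈ relations ⇒ w ∈ relations`. Why it might fail: only through the real-algebraic bookkeeping of `Re/Im` of a
complex rational function (closedness = Cauchy–Riemann); the analysis is classical. Sources: KZ §1.2 rules 1)–3);
Ahlfors, Complex Analysis, §4.2 (argument principle); this node. -/
def GreenReduction : Prop :=
  ∀ (n : ℕ) (g : (Fin n → ℝ) → ℝ) (U : Set (Fin n → ℝ)) (piece : IntegralRep n)
    (F : MvPolynomial (Fin (n + 1)) ℚ) (lo hi : Fin n → ℚ) (a b c ε : ℚ),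
    IsOpen U → piece.domain ⊆ U → IsSemialgebraicFunOn ℚ U g → AnalyticOnNhd ℝ g U →
    (∀ i, lo i < hi i) →
    piece.domain = Set.pi Set.univ (fun i : Fin n => Set.Icc ((lo i : ℚ) : ℝ) (hi i)) →
    (∀ z ∈ piece.domain, piece.integrand z = g z) →
    (∀ x ∈ piece.domain, aeval (Fin.snoc x (g x) : Fin (n + 1) → ℝ) F = 0) →
    (∀ x ∈ piece.domain, aeval (Fin.snoc x (g x) : Fin (n + 1) → ℝ) (pderiv (Fin.last n) F) ≠ 0) →
    (a < b ∧ 0 < ε ∧ ε < c ∧ (∀ x ∈ piece.domain, ((a : ℚ) : ℝ) + ((ε : ℚ) : ℝ) < g x ∧ g x + ((ε : ℚ) : ℝ) < ((b : ℚ) : ℝ)) ∧ (∀ x ∈ piece.domain, ∀ z : ℂ, ((a : ℚ) : ℝ) ≤ z.re → z.re ≤ ((b : ℚ) : ℝ) → |z.im| ≤ ((c : ℚ) : ℝ) → aeval (Fin.snoc (fun i => ((x i : ℝ) : ℂ)) z : Fin (n + 1) → ℂ) F = 0 → z = ((g x : ℝ) : ℂ))) →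
    ∃ (P₁ P₂ : IntegralRep (n + 1)),
      P₁.domain = KZlog.band piece.domain (fun _ => 0) (fun _ => (ε:ℝ)) ∧
      (∀ z ∈ P₁.domain,
        P₁.integrand z = 2 * g (Fin.init z) * (ε:ℝ) / ((ε:ℝ) ^ 2 + z (Fin.last n) ^ 2)) ∧
      P₂.domain = KZlog.band piece.domain (fun x => g x - ε) (fun x => g x + ε) ∧
      (∀ z ∈ P₂.domain,
        P₂.integrand z = g (Fin.init z) * (ε:ℝ) / ((z (Fin.last n) - g (Fin.init z)) ^ 2 + (ε:ℝ) ^ 2)) ∧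
      of P₁ + of P₂ ∈ relations ⊔ AddSubgroup.closure RatBoxSet

/-! ### Gen-4 final pass: `GreenReduction ⟸ OuterGreen ∧ InnerResidue ∧ OuterInSector` (proved glue)

The Green assembly, cut along its three natural seams. Edge representations (all over the base box `τ = piece.domain`,
`h := w·F_w/F`, real coordinates `w = u + iv`, `ReIm.ratRe/ratIm (ReIm.hNum F) F (x,u,v) = Re/Im h(x, u+iv)`):
`E1` = inner vertical pair (`Re h` at `u = g(x) ± ε`, `v ∈ [0,ε]`, right − left), `E2` = inner top edge (`Im h` at
`v = ε`, `u ∈ [g−ε, g+ε]`), `BQ` = outer vertical pair (`u = a, b`, `v ∈ [0,c]`), `BP` = outer top edge (`v = c`,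
`u ∈ [a,b]`). Bottom edges (`v = 0`) carry the zero integrand (`ReIm.ratIm_snoc_zero`). -/

/-- Intermediate statement S1: **outer Green.** Green (`ReIm.of_sub_of_mem_relations_green_rat`, PROVED)
for `h = w F_w/F` on the three rectangles `[a, g−ε]×[0,c]`, `[g+ε, b]×[0,c]`, `[g−ε, g+ε]×[ε,c]` of the upper
half-annulus (`F ≠ 0` there by `IsolatedOn`), bottom edges zero (`ReIm.ratIm_snoc_zero`), then domain additivity
(`KZ.domainAddRel`, `KZ.exists_split_band`) and integrand additivity to merge: `[E1] − [E2] − ([BQ] − [BP]) ∈ relations`.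
Why it might fail: it cannot mathematically; only rep-construction volume. Sources: KZ §1.2 rules 1)–3); this node. -/
def OuterGreen : Prop :=
  ∀ (n : ℕ) (g : (Fin n → ℝ) → ℝ) (U : Set (Fin n → ℝ)) (piece : IntegralRep n)
    (F : MvPolynomial (Fin (n + 1)) ℚ) (lo hi : Fin n → ℚ) (a b c ε : ℚ),
    IsOpen U → piece.domain ⊆ U → IsSemialgebraicFunOn ℚ U g → AnalyticOnNhd ℝ g U →
    (∀ i, lo i < hi i) →
    piece.domain = Set.pi Set.univ (fun i : Fin n => Set.Icc ((lo i : ℚ) : ℝ) (hi i)) →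
    (∀ z ∈ piece.domain, piece.integrand z = g z) →
    (∀ x ∈ piece.domain, aeval (Fin.snoc x (g x) : Fin (n + 1) → ℝ) F = 0) →
    (∀ x ∈ piece.domain, aeval (Fin.snoc x (g x) : Fin (n + 1) → ℝ) (pderiv (Fin.last n) F) ≠ 0) →
    (a < b ∧ 0 < ε ∧ ε < c ∧ (∀ x ∈ piece.domain, ((a : ℚ) : ℝ) + ((ε : ℚ) : ℝ) < g x ∧ g x + ((ε : ℚ) : ℝ) < ((b : ℚ) : ℝ)) ∧ (∀ x ∈ piece.domain, ∀ z : ℂ, ((a : ℚ) : ℝ) ≤ z.re → z.re ≤ ((b : ℚ) : ℝ) → |z.im| ≤ ((c : ℚ) : ℝ) → aeval (Fin.snoc (fun i => ((x i : ℝ) : ℂ)) z : Fin (n + 1) → ℂ) F = 0 → z = ((g x : ℝ) : ℂ))) →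
    ∃ (E1 E2 BQ BP : IntegralRep (n + 1)),
      (E1.domain = KZlog.band piece.domain (fun _ => 0) (fun _ => (ε:ℝ)) ∧ ∀ z ∈ E1.domain, E1.integrand z = ReIm.ratRe (ReIm.hNum F) F (Fin.snoc (Fin.snoc (Fin.init z) (g (Fin.init z) + (ε:ℝ)) : Fin (n + 1) → ℝ) (z (Fin.last n))) - ReIm.ratRe (ReIm.hNum F) F (Fin.snoc (Fin.snoc (Fin.init z) (g (Fin.init z) - (ε:ℝ)) : Fin (n + 1) → ℝ) (z (Fin.last n)))) ∧ (E2.domain = KZlog.band piece.domain (fun x => g x - ε) (fun x => g x + ε) ∧ ∀ z ∈ E2.domain, E2.integrand z = ReIm.ratIm (ReIm.hNum F) F (Fin.snoc z (ε:ℝ))) ∧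
      (BQ.domain = KZlog.band piece.domain (fun _ => 0) (fun _ => (c:ℝ)) ∧ ∀ z ∈ BQ.domain, BQ.integrand z = ReIm.ratRe (ReIm.hNum F) F (Fin.snoc (Fin.snoc (Fin.init z) (b:ℝ) : Fin (n + 1) → ℝ) (z (Fin.last n))) - ReIm.ratRe (ReIm.hNum F) F (Fin.snoc (Fin.snoc (Fin.init z) (a:ℝ) : Fin (n + 1) → ℝ) (z (Fin.last n)))) ∧ (BP.domain = KZlog.band piece.domain (fun _ => (a:ℝ)) (fun _ => (b:ℝ)) ∧ ∀ z ∈ BP.domain, BP.integrand z = ReIm.ratIm (ReIm.hNum F) F (Fin.snoc z (c:ℝ))) ∧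
      of E1 - of E2 - (of BQ - of BP) ∈ relations

/-- Intermediate statement S2: **inner residue.** On the inner square `[g−ε, g+ε]×[0,ε]`:
`h = pole + r` edge-wise (`ReIm.ratRe_ratIm_hNum_eq`, PROVED; pole parts = the `P₁`/`P₂` integrands), Green for the
remainder `r = Nr/Dr` at the graph parameter (`ReIm.of_sub_of_mem_relations_green_rat_gpt`, PROVED; `Dr ≠ 0` on the CLOSED square
by `ReIm.residue_identity` off the root and `Dr(x,g,g) = F_w(x,g) ≠ 0` at it), bottom edge zero, integrand additivity:
`[E1] − [E2] − ([P₁] + [P₂]) ∈ relations`. Why it might fail: it cannot mathematically (residue theorem for a simple pole,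
here a polynomial identity); only rep-construction volume. Sources: Ahlfors §4.2; this node. -/
def InnerResidue : Prop :=
  ∀ (n : ℕ) (g : (Fin n → ℝ) → ℝ) (U : Set (Fin n → ℝ)) (piece : IntegralRep n)
    (F : MvPolynomial (Fin (n + 1)) ℚ) (lo hi : Fin n → ℚ) (a b c ε : ℚ),
    IsOpen U → piece.domain ⊆ U → IsSemialgebraicFunOn ℚ U g → AnalyticOnNhd ℝ g U →
    (∀ i, lo i < hi i) →
    piece.domain = Set.pi Set.univ (fun i : Fin n => Set.Icc ((lo i : ℚ) : ℝ) (hi i)) →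
    (∀ z ∈ piece.domain, piece.integrand z = g z) →
    (∀ x ∈ piece.domain, aeval (Fin.snoc x (g x) : Fin (n + 1) → ℝ) F = 0) →
    (∀ x ∈ piece.domain, aeval (Fin.snoc x (g x) : Fin (n + 1) → ℝ) (pderiv (Fin.last n) F) ≠ 0) →
    (a < b ∧ 0 < ε ∧ ε < c ∧ (∀ x ∈ piece.domain, ((a : ℚ) : ℝ) + ((ε : ℚ) : ℝ) < g x ∧ g x + ((ε : ℚ) : ℝ) < ((b : ℚ) : ℝ)) ∧ (∀ x ∈ piece.domain, ∀ z : ℂ, ((a : ℚ) : ℝ) ≤ z.re → z.re ≤ ((b : ℚ) : ℝ) → |z.im| ≤ ((c : ℚ) : ℝ) → aeval (Fin.snoc (fun i => ((x i : ℝ) : ℂ)) z : Fin (n + 1) → ℂ) F = 0 → z = ((g x : ℝ) : ℂ))) →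
    ∃ (P₁ P₂ E1 E2 : IntegralRep (n + 1)),
      P₁.domain = KZlog.band piece.domain (fun _ => 0) (fun _ => (ε:ℝ)) ∧
      (∀ z ∈ P₁.domain,
        P₁.integrand z = 2 * g (Fin.init z) * (ε:ℝ) / ((ε:ℝ) ^ 2 + z (Fin.last n) ^ 2)) ∧
      P₂.domain = KZlog.band piece.domain (fun x => g x - ε) (fun x => g x + ε) ∧
      (∀ z ∈ P₂.domain,
        P₂.integrand z = g (Fin.init z) * (ε:ℝ) / ((z (Fin.last n) - g (Fin.init z)) ^ 2 + (ε:ℝ) ^ 2)) ∧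
      (E1.domain = KZlog.band piece.domain (fun _ => 0) (fun _ => (ε:ℝ)) ∧ ∀ z ∈ E1.domain, E1.integrand z = ReIm.ratRe (ReIm.hNum F) F (Fin.snoc (Fin.snoc (Fin.init z) (g (Fin.init z) + (ε:ℝ)) : Fin (n + 1) → ℝ) (z (Fin.last n))) - ReIm.ratRe (ReIm.hNum F) F (Fin.snoc (Fin.snoc (Fin.init z) (g (Fin.init z) - (ε:ℝ)) : Fin (n + 1) → ℝ) (z (Fin.last n)))) ∧ (E2.domain = KZlog.band piece.domain (fun x => g x - ε) (fun x => g x + ε) ∧ ∀ z ∈ E2.domain, E2.integrand z = ReIm.ratIm (ReIm.hNum F) F (Fin.snoc z (ε:ℝ))) ∧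
      of E1 - of E2 - (of P₁ + of P₂) ∈ relations

/-- Intermediate statement S3: **the outer edges lie in the rational-box sector** — `BQ`, `BP` are rational boxes
(`band (box lo hi) a b = box (snoc lo a) (snoc hi b)`) with ℚ-rational integrands (`ReIm.ratRe_eq/ratIm_eq` +
`MvPolynomial.bind₁` substitution of the constant coordinate) whose denominators do not vanish (`IsolatedOn`: no zero of
`F(x,·)` on the outer three sides). Why it might fail: it cannot. Sources: this node. -/
def OuterInSector : Prop :=
  ∀ (n : ℕ) (g : (Fin n → ℝ) → ℝ) (U : Set (Fin n → ℝ)) (piece : IntegralRep n)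
    (F : MvPolynomial (Fin (n + 1)) ℚ) (lo hi : Fin n → ℚ) (a b c ε : ℚ),
    IsOpen U → piece.domain ⊆ U → IsSemialgebraicFunOn ℚ U g → AnalyticOnNhd ℝ g U →
    (∀ i, lo i < hi i) →
    piece.domain = Set.pi Set.univ (fun i : Fin n => Set.Icc ((lo i : ℚ) : ℝ) (hi i)) →
    (∀ z ∈ piece.domain, piece.integrand z = g z) →
    (∀ x ∈ piece.domain, aeval (Fin.snoc x (g x) : Fin (n + 1) → ℝ) F = 0) →
    (∀ x ∈ piece.domain, aeval (Fin.snoc x (g x) : Fin (n + 1) → ℝ) (pderiv (Fin.last n) F) ≠ 0) →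
    (a < b ∧ 0 < ε ∧ ε < c ∧ (∀ x ∈ piece.domain, ((a : ℚ) : ℝ) + ((ε : ℚ) : ℝ) < g x ∧ g x + ((ε : ℚ) : ℝ) < ((b : ℚ) : ℝ)) ∧ (∀ x ∈ piece.domain, ∀ z : ℂ, ((a : ℚ) : ℝ) ≤ z.re → z.re ≤ ((b : ℚ) : ℝ) → |z.im| ≤ ((c : ℚ) : ℝ) → aeval (Fin.snoc (fun i => ((x i : ℝ) : ℂ)) z : Fin (n + 1) → ℂ) F = 0 → z = ((g x : ℝ) : ℂ))) →
    ∀ (BQ BP : IntegralRep (n + 1)), (BQ.domain = KZlog.band piece.domain (fun _ => 0) (fun _ => (c:ℝ)) ∧ ∀ z ∈ BQ.domain, BQ.integrand z = ReIm.ratRe (ReIm.hNum F) F (Fin.snoc (Fin.snoc (Fin.init z) (b:ℝ) : Fin (n + 1) → ℝ) (z (Fin.last n))) - ReIm.ratRe (ReIm.hNum F) F (Fin.snoc (Fin.snoc (Fin.init z) (a:ℝ) : Fin (n + 1) → ℝ) (z (Fin.last n)))) → (BP.domain = KZlog.band piece.domain (fun _ => (a:ℝ)) (fun _ => (b:ℝ))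 ∧ ∀ z ∈ BP.domain, BP.integrand z = ReIm.ratIm (ReIm.hNum F) F (Fin.snoc z (c:ℝ))) →
      of BQ ∈ RatBoxSet ∧ of BP ∈ RatBoxSet

/-! ### S3 lemmas -/

/-- Numerator polynomial of `Re(N/D)`. -/
def ReA {n : ℕ} (N D : MvPolynomial (Fin (n + 1)) ℚ) : MvPolynomial (Fin (n + 2)) ℚ :=
  ReIm.reP N * ReIm.reP D + ReIm.imP N * ReIm.imP D

/-- Numerator polynomial of `Im(N/D)`. -/
def ImA {n : ℕ} (N D : MvPolynomial (Fin (n + 1)) ℚ) : MvPolynomial (Fin (n + 2)) ℚ :=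
  ReIm.imP N * ReIm.reP D - ReIm.reP N * ReIm.imP D

/-- Denominator polynomial `|D|²`. -/
def Bsq {n : ℕ} (D : MvPolynomial (Fin (n + 1)) ℚ) : MvPolynomial (Fin (n + 2)) ℚ :=
  ReIm.reP D ^ 2 + ReIm.imP D ^ 2

/-- Auxiliary step `ratRe_eq'`. [bookkeeping] -/
theorem ratRe_eq' {n : ℕ} (N D : MvPolynomial (Fin (n + 1)) ℚ) (w : Fin (n + 2) → ℝ) :
    ReIm.ratRe N D w = aeval w (ReA N D) / aeval w (Bsq D) := ReIm.ratRe_eq N D w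

/-- Auxiliary step `ratIm_eq'`. [bookkeeping] -/
theorem ratIm_eq' {n : ℕ} (N D : MvPolynomial (Fin (n + 1)) ℚ) (w : Fin (n + 2) → ℝ) :
    ReIm.ratIm N D w = aeval w (ImA N D) / aeval w (Bsq D) := ReIm.ratIm_eq N D w

/-- Auxiliary step `aeval_Bsq_ne_zero`. [bookkeeping] -/
theorem aeval_Bsq_ne_zero {n : ℕ} (D : MvPolynomial (Fin (n + 1)) ℚ) (w : Fin (n + 2) → ℝ)
    (hD : aeval (ReIm.cplxPoint w) D ≠ 0) : aeval w (Bsq D) ≠ 0 := ReIm.aeval_normSqP_ne_zero D w hD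

/-- A band with constant rational bounds over a rational box is a rational box. -/
theorem band_box_const {n : ℕ} (lo hi : Fin n → ℚ) (α β : ℚ) :
    KZlog.band (Set.pi Set.univ (fun i : Fin n => Set.Icc ((lo i : ℚ) : ℝ) (hi i))) (fun _ => (α:ℝ)) (fun _ => (β:ℝ)) =
      Set.pi Set.univ (fun j : Fin (n + 1) => Set.Icc (((Fin.snoc lo α : Fin (n + 1) → ℚ) j : ℚ) : ℝ)
        ((Fin.snoc hi β : Fin (n + 1) → ℚ) j)) := by
  ext z
  simp only [KZlog.band, Set.mem_setOf_eq, Set.mem_pi, Set.mem_univ, true_implies, Set.mem_Icc]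
  constructor
  · rintro ⟨h1, h2, h3⟩ j
    refine Fin.lastCases ?_ (fun i => ?_) j
    · simpa using And.intro h2 h3
    · simpa [Fin.init] using h1 i
  · intro h
    refine ⟨fun i => by simpa [Fin.init] using h (Fin.castSucc i), ?_, ?_⟩
    · simpa using (h (Fin.last n)).1
    · simpa using (h (Fin.last n)).2

/-- Auxiliary step `snoc_lt_snoc`. [bookkeeping] -/
theorem snoc_lt_snoc {n : ℕ} {lo hi : Fin n → ℚ} (h : ∀ i, lo i < hi i) {α β : ℚ} (hαβ : α < β) :
    ∀ j, (Fin.snoc lo α : Fin (n + 1) → ℚ) j < (Fin.snoc hi β : Fin (n + 1) → ℚ) j := by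
  intro j
  refine Fin.lastCases ?_ (fun i => ?_) j
  · simpa using hαβ
  · simpa using h i

/-- Substitution `u := b` (constant) in `ℚ[x,u,v]`, keeping `(x,v)`. -/
def substU (n : ℕ) (b : ℚ) : Fin (n + 2) → MvPolynomial (Fin (n + 1)) ℚ :=
  Fin.snoc (Fin.snoc (fun i : Fin n => X (Fin.castSucc i)) (C b)) (X (Fin.last n))

/-- Auxiliary step `substU_eval`. [bookkeeping] -/
theorem substU_eval {n : ℕ} (b : ℚ) (z : Fin (n + 1) → ℝ) :
    (fun j => aeval z (substU n b j)) =
      (Fin.snoc (Fin.snoc (Fin.init z) (b:ℝ) : Fin (n + 1) → ℝ) (z (Fin.last n)) : Fin (n + 2) → ℝ) := by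
  funext j
  refine Fin.lastCases ?_ (fun j' => ?_) j
  · simp [substU]
  · refine Fin.lastCases ?_ (fun i => ?_) j'
    · simp [substU]
    · simp [substU, Fin.init]

/-- Auxiliary step `aeval_substU`. [bookkeeping] -/
theorem aeval_substU {n : ℕ} (b : ℚ) (z : Fin (n + 1) → ℝ) (R : MvPolynomial (Fin (n + 2)) ℚ) :
    aeval z (bind₁ (substU n b) R) =
      aeval (Fin.snoc (Fin.snoc (Fin.init z) (b:ℝ) : Fin (n + 1) → ℝ) (z (Fin.last n))) R := by
  rw [aeval_bind₁, substU_eval]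

/-- Substitution `v := c` (constant) in `ℚ[y,v]`, keeping `y`. -/
def substV (n : ℕ) (c : ℚ) : Fin (n + 2) → MvPolynomial (Fin (n + 1)) ℚ :=
  Fin.snoc (fun j : Fin (n + 1) => X j) (C c)

/-- Auxiliary step `substV_eval`. [bookkeeping] -/
theorem substV_eval {n : ℕ} (c : ℚ) (z : Fin (n + 1) → ℝ) :
    (fun j => aeval z (substV n c j)) = (Fin.snoc z (c:ℝ) : Fin (n + 2) → ℝ) := by
  funext j
  refine Fin.lastCases ?_ (fun j' => ?_) j
  · simp [substV]
  · simp [substV]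

/-- Auxiliary step `aeval_substV`. [bookkeeping] -/
theorem aeval_substV {n : ℕ} (c : ℚ) (z : Fin (n + 1) → ℝ) (R : MvPolynomial (Fin (n + 2)) ℚ) :
    aeval z (bind₁ (substV n c) R) = aeval (Fin.snoc z (c:ℝ) : Fin (n + 2) → ℝ) R := by
  rw [aeval_bind₁, substV_eval]

/-- No zero of `F(x,·)` at `s + iv` when `(s,v)` is in the rectangle and `s + iv ≠ g x`. -/
theorem aeval_cplxPoint_ne_zero_of_isolated {n : ℕ} {g : (Fin n → ℝ) → ℝ} {F : MvPolynomial (Fin (n + 1)) ℚ}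
    {D : Set (Fin n → ℝ)} {a b c ε : ℚ} (hiso : (a < b ∧ 0 < ε ∧ ε < c ∧ (∀ x ∈ D, ((a : ℚ) : ℝ) + ((ε : ℚ) : ℝ) < g x ∧ g x + ((ε : ℚ) : ℝ) < ((b : ℚ) : ℝ)) ∧ (∀ x ∈ D, ∀ z : ℂ, ((a : ℚ) : ℝ) ≤ z.re → z.re ≤ ((b : ℚ) : ℝ) → |z.im| ≤ ((c : ℚ) : ℝ) → aeval (Fin.snoc (fun i => ((x i : ℝ) : ℂ)) z : Fin (n + 1) → ℂ) F = 0 → z = ((g x : ℝ) : ℂ)))) {x : Fin n → ℝ} (hx : x ∈ D)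
    {s v : ℝ} (ha : (a:ℝ) ≤ s) (hb : s ≤ (b:ℝ)) (hv : |v| ≤ (c:ℝ)) (hne : ¬ (s = g x ∧ v = 0)) :
    aeval (ReIm.cplxPoint (Fin.snoc (Fin.snoc x s : Fin (n + 1) → ℝ) v)) F ≠ 0 := by
  intro h0
  rw [ReIm.cplxPoint_snoc_snoc] at h0
  have := hiso.2.2.2.2 x hx ((s:ℂ) + (v:ℂ) * Complex.I) (by simpa using ha) (by simpa using hb)
    (by simpa using hv) h0
  apply hne
  have hre := congrArg Complex.re this
  have him := congrArg Complex.im this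
  simp at hre him
  exact ⟨hre, him⟩

/-- **S3 `OuterInSector` HOLDS** (PROVED: `bind₁` presentation of `Re/Im h` on the constant-coordinate
edges + `band = box` + non-vanishing from `IsolatedOn`). -/
theorem outerInSector_holds : OuterInSector := by
  intro n g U piece F lo hi a b c ε hU hsub hg han hlohi hdom hint hF hFz hiso BQ BP hBQ hBP
  have hab : a < b := hiso.1
  have hε : 0 < ε := hiso.2.1
  have hc : 0 < c := hiso.2.1.trans hiso.2.2.1
  have hmarg := hiso.2.2.2.1
  have hBQdom : ∀ z ∈ BQ.domain, Fin.init z ∈ piece.domain ∧ 0 ≤ z (Fin.last n) ∧ z (Fin.last n) ≤ (c:ℝ) := by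
    intro z hz; rw [hBQ.1] at hz; exact ⟨hz.1, hz.2.1, hz.2.2⟩
  have hBPdom : ∀ z ∈ BP.domain, Fin.init z ∈ piece.domain ∧ (a:ℝ) ≤ z (Fin.last n) ∧ z (Fin.last n) ≤ (b:ℝ) := by
    intro z hz; rw [hBP.1] at hz; exact ⟨hz.1, hz.2.1, hz.2.2⟩
  have hFb : ∀ z ∈ BQ.domain,
      aeval (ReIm.cplxPoint (Fin.snoc (Fin.snoc (Fin.init z) (b:ℝ) : Fin (n + 1) → ℝ) (z (Fin.last n)))) F ≠ 0 := by
    intro z hz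
    obtain ⟨hx, h0, h1⟩ := hBQdom z hz
    refine aeval_cplxPoint_ne_zero_of_isolated hiso hx (by exact_mod_cast hab.le) le_rfl
      (by rw [abs_of_nonneg h0]; exact h1) ?_
    rintro ⟨hgb, -⟩
    have := (hmarg _ hx).2
    have hε' : (0:ℝ) < ε := by exact_mod_cast hε
    linarith
  have hFa : ∀ z ∈ BQ.domain,
      aeval (ReIm.cplxPoint (Fin.snoc (Fin.snoc (Fin.init z) (a:ℝ) : Fin (n + 1) → ℝ) (z (Fin.last n)))) F ≠ 0 := by
    intro z hz
    obtain ⟨hx, h0, h1⟩ := hBQdom z hz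
    refine aeval_cplxPoint_ne_zero_of_isolated hiso hx le_rfl (by exact_mod_cast hab.le)
      (by rw [abs_of_nonneg h0]; exact h1) ?_
    rintro ⟨hga, -⟩
    have := (hmarg _ hx).1
    have hε' : (0:ℝ) < ε := by exact_mod_cast hε
    linarith
  have hFc : ∀ z ∈ BP.domain, aeval (ReIm.cplxPoint (Fin.snoc z (c:ℝ) : Fin (n + 2) → ℝ)) F ≠ 0 := by
    intro z hz
    obtain ⟨hx, h0, h1⟩ := hBPdom z hz
    have hz' : (Fin.snoc z (c:ℝ) : Fin (n + 2) → ℝ) =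
        Fin.snoc (Fin.snoc (Fin.init z) (z (Fin.last n)) : Fin (n + 1) → ℝ) (c:ℝ) := by
      rw [Fin.snoc_init_self]
    rw [hz']
    refine aeval_cplxPoint_ne_zero_of_isolated hiso hx h0 h1 (by rw [abs_of_pos (by exact_mod_cast hc)]) ?_
    rintro ⟨-, hc0⟩
    have hc' : (0:ℝ) < c := by exact_mod_cast hc
    exact hc'.ne' hc0
  have hbandQ := band_box_const lo hi 0 c
  simp only [Rat.cast_zero] at hbandQ
  refine ⟨⟨n + 1, BQ, Fin.snoc lo 0, Fin.snoc hi c,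
      bind₁ (substU n b) (ReA (ReIm.hNum F) F) * bind₁ (substU n a) (Bsq F) -
        bind₁ (substU n a) (ReA (ReIm.hNum F) F) * bind₁ (substU n b) (Bsq F),
      bind₁ (substU n b) (Bsq F) * bind₁ (substU n a) (Bsq F), snoc_lt_snoc hlohi hc, ?_, ?_, ?_, rfl⟩,
    ⟨n + 1, BP, Fin.snoc lo a, Fin.snoc hi b, bind₁ (substV n c) (ImA (ReIm.hNum F) F), bind₁ (substV n c) (Bsq F),
      snoc_lt_snoc hlohi hab, ?_, ?_, ?_, rfl⟩⟩
  · rw [hBQ.1, hdom, hbandQ]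
  · intro z hz
    rw [map_mul, aeval_substU, aeval_substU]
    exact mul_ne_zero (aeval_Bsq_ne_zero F _ (hFb z hz)) (aeval_Bsq_ne_zero F _ (hFa z hz))
  · intro z hz
    rw [hBQ.2 z hz, ratRe_eq', ratRe_eq', map_mul, map_sub, map_mul, map_mul, aeval_substU, aeval_substU,
      aeval_substU, aeval_substU,
      div_sub_div _ _ (aeval_Bsq_ne_zero F _ (hFb z hz)) (aeval_Bsq_ne_zero F _ (hFa z hz))]
    ring
  · rw [hBP.1, hdom, band_box_const]
  · intro z hz
    rw [aeval_substV]
    exact aeval_Bsq_ne_zero F _ (hFc z hz)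
  · intro z hz
    rw [hBP.2 z hz, ratIm_eq', aeval_substV, aeval_substV]

end Summit.KontsevichZagierPeriods.RootDecompRationalCubeDichotomy.Rung27842.SimpleBranch
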